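import Summits.ResolutionOfSingularities.ResolutionOfSingularities.Theorems.WeightedInvariantOrbitCentreHomogeneous
import Summits.ResolutionOfSingularities.ResolutionOfSingularities.Theorems.WeightedInvariantAQSBaseChangeTheorem
import HarnessLib

/-!
# (hom) for all chart gradings of the orbit centre — UNCONDITIONALLY in the separable-base-change clause
# (L3 of the e-ladder rung `e = 1`, with `AbramovichQuekSchober2025_separableBaseChange` DISCHARGED at `k(ℤʲ)`)

Route `ResolutionOfSingularities/WeightedInvariant`, door crux `HypersurfaceCentreConstruction`
(stmt-ResolutionOfSingularities-19897) — OURS, helper; e-ladder `e = 1`, (U1) of res-D-pv-025 AS stub-10 (STATUS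
2026-08-27T11:41Z): res-type-047's `OrbitCentreHomogeneous.isHomogeneous_comap_weightedMonomialIdeal_of_separableBaseChange`
(p515852, §7) and its scheme-level closer (§8) invoke the vendored fact `AbramovichQuekSchober2025_separableBaseChange`
ONLY for the base change to `k′ = k(ℤʲ) = Frac k[ℤʲ]`, which is formally smooth AND essentially of finite type over `k`;
there the fact is now a THEOREM (`AQSBaseChange.separableBaseChange_of_essFiniteType`, file `…AQSBaseChangeTheorem`).
This file re-derives both statements WITHOUT the hypothesis `hAQS₂` (and without the now idle «`≠ ⊥`», «not `(y^ν)`»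
hypotheses): the proofs are res-type-047's, verbatim but for the one call (credit: res-type-047, p512975/p514770/p515852).

* `isHomogeneous_comap_weightedMonomialIdeal_unconditional` — (L3) at ring level;
* `isHomogeneous_germContractionIdeal_weightedMonomialIdeal_unconditional` — the closer in the e-ladder's vocabulary.

No definitions.  Nothing here is a claim about Hironaka's problem or about any manuscript under adjudication;
AI-written, weaker than expert review.  [cite: AbramovichQuekSchober2025, Thm 1.1 (1) via Thm 3.5 and §5 (i)]
-/

noncomputable section

set_option linter.dupNamespace false -- mandated namespace of this single-conjunct summit

namespace Summit.ResolutionOfSingularities.ResolutionOfSingularities.Theorems.OrbitCentreHomogeneous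

open AddMonoidAlgebra DatumToEmbedded.CentreHomogeneous IsLocalRing CategoryTheory AlgebraicGeometry
open Literature.AlgebraicGeometry.Resolution
open scoped AlgebraMonoidAlgebra nonZeroDivisors

/-! ## (L3) at ring level, unconditionally -/

section Main

variable {k : Type} [Field k] {j : ℕ} {A : Type} [CommRing A] [Algebra k A]

/-- **(L3) «(hom) for all chart gradings of the orbit centre», unconditionally.**  Let `A` be a finitely generated
`k`-algebra graded by `ℤʲ` (`𝒜`), `F ⊆ A` a homogeneous ideal and `P` a homogeneous prime such that `O = A_P` is regular
of dimension `2` and `F · O` is principal, and `(x; w; ℓ)` the lex-maximal admissible weighted centre germ of `F · O`.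
Then every contracted piece `A ∩ (x^α : w·α ≥ n)` is HOMOGENEOUS.  (res-type-047's theorem p515852 with the
separable-base-change clause discharged at `k(ℤʲ)` by `AQSBaseChange.separableBaseChange_of_essFiniteType`.)
[cite: AbramovichQuekSchober2025, Thm 3.5 and §5 (i)] -/
theorem isHomogeneous_comap_weightedMonomialIdeal_unconditional
    [Algebra.FiniteType k A] {σ : Type} [SetLike σ A] [AddSubgroupClass σ A]
    (𝒜 : (Fin j → ℤ) → σ) [GradedRing 𝒜]
    (F : Ideal A) (hF : F.IsHomogeneous 𝒜) (P : Ideal A) [P.IsPrime] (hP : P.IsHomogeneous 𝒜)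
    (O : Type) [CommRing O] [IsLocalRing O] [Algebra A O] [IsLocalization.AtPrime O P]
    (hreg : IsRegularLocalRing O) (hdim : ringKrullDim O = ((2 : ℕ) : WithBot ℕ∞))
    (hprinc : (F.map (algebraMap A O)).IsPrincipal)
    (x : Fin 2 → O) (w : Fin 2 → ℕ) (ℓ : ℕ)
    (hx : IsLexMaxWeightedCentreGerm O (F.map (algebraMap A O)) x w ℓ) (n : ℕ) :
    ((weightedMonomialIdeal x w n).comap (algebraMap A O)).IsHomogeneous 𝒜 := by
  classical
  obtain ⟨ρ, hρ⟩ := exists_coaction 𝒜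
  haveI : IsNoetherianRing A := Algebra.FiniteType.isNoetherianRing k A
  -- the prime of the generic torus point
  haveI h𝔓 : (P.map (singleZeroRingHom : A →+* A[Fin j → ℤ])).IsPrime := isPrime_map_singleZeroRingHom P
  -- the affine model `Y₀ = Spec A → Spec k` with the ideal sheaf of `F`
  let f₀ : Spec (.of A) ⟶ Spec (.of k) := Spec.map (CommRingCat.ofHom (algebraMap k A))
  haveI : LocallyOfFiniteType f₀ := by
    rw [HasRingHomProperty.Spec_iff (P := @LocallyOfFiniteType)]
    exact RingHom.finiteType_algebraMap.mpr ‹_›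
  let X₀ : (Spec (.of A)).IdealSheafData :=
    Scheme.IdealSheafData.ofIdealTop (F.map (Scheme.ΓSpecIso (.of A)).inv.hom)
  -- the torus-generic base change `Y′ = Spec (A[ℤʲ]_S) → Y₀` over `Spec k(ℤʲ) → Spec k`
  let R' : Type := Localization (Algebra.algebraMapSubmonoid A[Fin j → ℤ] (k[Fin j → ℤ])⁰)
  let g : Spec (.of R') ⟶ Spec (.of A) := Spec.map (CommRingCat.ofHom (algebraMap A R'))
  have hsq : IsPullback g (Spec.map (CommRingCat.ofHom (algebraMap (FractionRing k[Fin j → ℤ]) R'))) f₀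
      (Spec.map (CommRingCat.ofHom (algebraMap k (FractionRing k[Fin j → ℤ])))) :=
    isPullback_SpecMap_of_isPushout _ _ _ _ (isPushout_fractionRing_localization k j A)
  haveI : Algebra.FormallySmooth k (FractionRing k[Fin j → ℤ]) := formallySmooth_fractionRing_addMonoidAlgebra k j
  -- the point `η′ = P · A[ℤʲ]` of `Y′`
  have hdisj := disjoint_algebraMapSubmonoid_map_singleZeroRingHom k j A P Ideal.IsPrime.ne_top'
  haveI h𝔓' : ((P.map (singleZeroRingHom : A →+* A[Fin j → ℤ])).map (algebraMap A[Fin j → ℤ] R')).IsPrime :=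
    IsLocalization.isPrime_of_isPrime_disjoint _ R' _ h𝔓 hdisj
  let η' : Spec (.of R') := ⟨(P.map (singleZeroRingHom : A →+* A[Fin j → ℤ])).map (algebraMap A[Fin j → ℤ] R'), h𝔓'⟩
  have hη'comap : η'.asIdeal.comap (algebraMap A[Fin j → ℤ] R') = P.map singleZeroRingHom :=
    IsLocalization.under_map_of_isPrime_disjoint _ R' h𝔓 hdisj
  have hAR' : algebraMap A R' = (algebraMap A[Fin j → ℤ] R').comp (singleZeroRingHom : A →+* A[Fin j → ℤ]) :=
    IsScalarTower.algebraMap_eq A A[Fin j → ℤ] R'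
  have hη₀ : (g.base η').asIdeal = P := by
    change (PrimeSpectrum.comap (algebraMap A R') η').asIdeal = P
    rw [PrimeSpectrum.comap_asIdeal, hAR', ← Ideal.comap_comap, hη'comap, comap_map_singleZeroRingHom]
  -- the local ring of `Y₀` at `η₀ = g η′` is a localization of `A` at `P`; compare with `O`
  letI algO₀ : Algebra A ((Spec (.of A)).presheaf.stalk (g.base η')) :=
    (StructureSheaf.toStalk A (g.base η')).hom.toAlgebra
  have hloc : IsLocalization.AtPrime ((Spec (.of A)).presheaf.stalk (g.base η')) (g.base η').asIdeal :=
    StructureSheaf.IsLocalization.to_stalk A (g.base η')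
  haveI : IsLocalization.AtPrime ((Spec (.of A)).presheaf.stalk (g.base η')) P := by
    have hM : P.primeCompl = (g.base η').asIdeal.primeCompl := by
      ext a; simp only [Ideal.mem_primeCompl_iff, hη₀]
    change IsLocalization P.primeCompl _
    rw [hM]
    exact hloc
  let e : O ≃+* (Spec (.of A)).presheaf.stalk (g.base η') :=
    (IsLocalization.algEquiv P.primeCompl O ((Spec (.of A)).presheaf.stalk (g.base η'))).toRingEquiv
  have he : (e : O →+* (Spec (.of A)).presheaf.stalk (g.base η')).comp (algebraMap A O) =
      algebraMap A ((Spec (.of A)).presheaf.stalk (g.base η')) :=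
    (IsLocalization.algEquiv P.primeCompl O ((Spec (.of A)).presheaf.stalk (g.base η'))).toAlgHom.comp_algebraMap
  have hFe : (F.map (algebraMap A O)).map (e : O →+* (Spec (.of A)).presheaf.stalk (g.base η')) =
      F.map (algebraMap A ((Spec (.of A)).presheaf.stalk (g.base η'))) := by
    rw [Ideal.map_map, he]
  -- the stalk of `X₀` at `η₀`
  have hX₀ : stalkIdeal X₀ (g.base η') = F.map (algebraMap A ((Spec (.of A)).presheaf.stalk (g.base η'))) := by
    rw [stalkIdeal_eq_map_germ X₀ ⟨⊤, isAffineOpen_top _⟩ trivial]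
    simp only [X₀, Scheme.IdealSheafData.ofIdealTop_ideal, Ideal.map_map]
    congr 1
  -- transport of the hypotheses at `η` from `O` to the stalk `O₀` of `Y₀` at `η₀`
  set O₀ := ((Spec (.of A)).presheaf.stalk (g.base η') : Type) with hO₀def
  have hreg₀ : IsRegularLocalRing O₀ := IsRegularLocalRing.of_ringEquiv e
  have hdim₀ : ringKrullDim O₀ = ((2 : ℕ) : WithBot ℕ∞) := by
    rw [← ringKrullDim_eq_of_ringEquiv e]; exact hdim
  have hprinc₀ : (stalkIdeal X₀ (g.base η')).IsPrincipal := by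
    obtain ⟨a, ha⟩ := hprinc
    refine ⟨⟨e a, ?_⟩⟩
    rw [hX₀, ← hFe, ha, Ideal.submodule_span_eq, Ideal.map_span, Set.image_singleton,
      Ideal.submodule_span_eq]
    rfl
  have hx₀ : IsLexMaxWeightedCentreGerm O₀ (stalkIdeal X₀ (g.base η')) (fun i => e (x i)) w ℓ := by
    rw [hX₀, ← hFe]
    exact LexMaxCentre.map_ringEquiv hx e
  -- the stalk `B` of `Y′` at `η′`: a localization of `A[ℤʲ]` at `P · A[ℤʲ]`, of dimension `2`
  set B := ((Spec (.of R')).presheaf.stalk η' : Type) with hBdef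
  letI algB' : Algebra R' B := (StructureSheaf.toStalk R' η').hom.toAlgebra
  have hlocB' : IsLocalization.AtPrime B η'.asIdeal := StructureSheaf.IsLocalization.to_stalk R' η'
  letI algB : Algebra A[Fin j → ℤ] B := ((algebraMap R' B).comp (algebraMap A[Fin j → ℤ] R')).toAlgebra
  haveI : IsScalarTower A[Fin j → ℤ] R' B := ⟨fun a r b => by
    simp only [Algebra.smul_def, RingHom.algebraMap_toAlgebra, RingHom.comp_apply, map_mul, mul_assoc]⟩
  haveI hlocB : IsLocalization.AtPrime B (P.map (singleZeroRingHom : A →+* A[Fin j → ℤ])) := by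
    have h := IsLocalization.isLocalization_isLocalization_atPrime_isLocalization
      (Algebra.algebraMapSubmonoid A[Fin j → ℤ] (k[Fin j → ℤ])⁰) (T := B) η'.asIdeal
    have hM : (P.map (singleZeroRingHom : A →+* A[Fin j → ℤ])).primeCompl =
        (η'.asIdeal.comap (algebraMap A[Fin j → ℤ] R')).primeCompl := by
      ext a; simp only [Ideal.mem_primeCompl_iff, hη'comap]
    change IsLocalization (P.map (singleZeroRingHom : A →+* A[Fin j → ℤ])).primeCompl B
    rw [hM]
    exact h
  have hdimB : ringKrullDim B = ((2 : ℕ) : WithBot ℕ∞) := by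
    rw [ringKrullDim_eq_of_isLocalization_atPrime_map P O (P.map (singleZeroRingHom : A →+* A[Fin j → ℤ])) rfl B]
    exact hdim
  -- Abramovich–Quek–Schober's separable base change at `k(ℤʲ)`, read at `η′`
  haveI : Algebra.EssFiniteType k (FractionRing k[Fin j → ℤ]) := by
    haveI : Algebra.EssFiniteType k[Fin j → ℤ] (FractionRing k[Fin j → ℤ]) :=
      Algebra.EssFiniteType.of_isLocalization (FractionRing k[Fin j → ℤ]) (k[Fin j → ℤ])⁰
    exact Algebra.EssFiniteType.comp k k[Fin j → ℤ] (FractionRing k[Fin j → ℤ])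
  have H := AQSBaseChange.separableBaseChange_of_essFiniteType k (Spec (.of A)) f₀ X₀ (FractionRing k[Fin j → ℤ])
    (Spec (.of R')) (Spec.map (CommRingCat.ofHom (algebraMap (FractionRing k[Fin j → ℤ]) R'))) g hsq η' hdimB
    hreg₀ hdim₀ hprinc₀ (fun i => e (x i)) w ℓ hx₀
  -- the two local maps `ε_P, ρ_P : O → B`
  let εP : O →+* B := (g.stalkMap η').hom.comp (e : O →+* O₀)
  have hstalk : (g.stalkMap η').hom.comp (algebraMap A O₀) =
      (algebraMap R' B).comp (algebraMap A R') := by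
    have h := congrArg CommRingCat.Hom.hom
      (AlgebraicGeometry.stalkMap_toStalk (CommRingCat.ofHom (algebraMap A R')) η')
    exact h
  have hε : εP.comp (algebraMap A O) =
      (algebraMap A[Fin j → ℤ] B).comp (singleZeroRingHom : A →+* A[Fin j → ℤ]) := by
    rw [RingHom.comp_assoc, he, hstalk, hAR', ← RingHom.comp_assoc]
    rfl
  have hunit : ∀ s : P.primeCompl, IsUnit (((algebraMap A[Fin j → ℤ] B).comp ρ) s) := by
    intro s
    exact IsLocalization.map_units B
      (⟨ρ s, coaction_not_mem_map_of_not_mem 𝒜 ρ hρ P s.2⟩ : (P.map (singleZeroRingHom : A →+* A[Fin j → ℤ])).primeCompl)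
  let ρP : O →+* B := IsLocalization.lift (M := P.primeCompl) (S := O) hunit
  have hρP : ρP.comp (algebraMap A O) = (algebraMap A[Fin j → ℤ] B).comp ρ :=
    IsLocalization.lift_comp hunit
  -- `x` spans `P · O`
  have hxspan : Ideal.span (Set.range x) = P.map (algebraMap A O) := by
    rw [hx.1, ← IsLocalization.AtPrime.under_maximalIdeal O P, Ideal.under_def,
      IsLocalization.map_under P.primeCompl (S := O)]
  -- the lex-maximal centre at the generic torus point, in the kernel's shape
  have hB : IsLexMaxWeightedCentreGerm B ((F.map (algebraMap A O)).map εP) (fun i => εP (x i)) w ℓ := by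
    have hI : (F.map (algebraMap A O)).map εP = stalkIdeal (X₀.comap g) η' := by
      rw [stalkIdeal_comap_eq_map_stalkMap, hX₀, ← hFe]
      simp only [Ideal.map_map]
      rfl
    rw [hI]
    exact H
  exact isHomogeneous_comap_weightedMonomialIdeal 𝒜 ρ hρ P O (P.map (singleZeroRingHom : A →+* A[Fin j → ℤ]))
    rfl B εP ρP hε hρP hP F hF x w ℓ hxspan hB n

end Main

/-! ## The closer in the e-ladder's vocabulary, unconditionally -/

section Scheme

/-- **(L3), scheme level, unconditionally**: for `f : Y → Spec k` locally of finite type, `X` an ideal sheaf, `η` a point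
with regular 2-dimensional local ring at which `X_η` is principal, `(x; w; ℓ)` lex-maximal for `X_η`, an affine open
`W ∋ η` and ANY `ℤʲ`-grading `𝒜` of `Γ(Y, W)` with `X(W)` and the prime of `η` homogeneous, every contracted piece
`germContractionIdeal η (x^α : w·α ≥ n) W` is homogeneous — res-type-047's closer without `hAQS₂`.
[cite: AbramovichQuekSchober2025, Thm 1.1 (1) via Thm 3.5 and §5 (i)] -/
theorem isHomogeneous_germContractionIdeal_weightedMonomialIdeal_unconditional
    {k : Type} [Field k] {Y : Scheme.{0}} (f : Y ⟶ Spec (.of k)) [LocallyOfFiniteType f]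
    (X : Y.IdealSheafData) (η : Y)
    (hreg : IsRegularLocalRing (Y.presheaf.stalk η))
    (hdim : ringKrullDim (Y.presheaf.stalk η) = ((2 : ℕ) : WithBot ℕ∞))
    (hprinc : (stalkIdeal X η).IsPrincipal)
    (x : Fin 2 → Y.presheaf.stalk η) (w : Fin 2 → ℕ) (ℓ : ℕ)
    (hx : IsLexMaxWeightedCentreGerm (Y.presheaf.stalk η) (stalkIdeal X η) x w ℓ)
    {j : ℕ} (W : Y.affineOpens) (hηW : η ∈ (W : Y.Opens))
    (𝒜 : (Fin j → ℤ) → AddSubgroup Γ(Y, W)) [GradedRing 𝒜]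
    (hX : (X.ideal W).IsHomogeneous 𝒜)
    (hP : ((W.2.primeIdealOf ⟨η, hηW⟩).asIdeal).IsHomogeneous 𝒜) (n : ℕ) :
    (germContractionIdeal η (weightedMonomialIdeal x w n) W).IsHomogeneous 𝒜 := by
  letI algk : Algebra k Γ(Y, W) :=
    ((f.appLE ⊤ (W : Y.Opens) le_top).hom.comp (Scheme.ΓSpecIso (.of k)).inv.hom).toAlgebra
  haveI : Algebra.FiniteType k Γ(Y, W) := by
    have h1 : (f.appLE ⊤ (W : Y.Opens) le_top).hom.FiniteType :=
      HasRingHomProperty.appLE @LocallyOfFiniteType f inferInstance ⟨⊤, isAffineOpen_top _⟩ W le_top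
    have h2 : ((f.appLE ⊤ (W : Y.Opens) le_top).hom.comp (Scheme.ΓSpecIso (.of k)).inv.hom).FiniteType :=
      h1.comp (RingHom.FiniteType.of_surjective _
        (Scheme.ΓSpecIso (.of k)).commRingCatIsoToRingEquiv.symm.surjective)
    exact h2
  letI := TopCat.Presheaf.algebra_section_stalk Y.presheaf (⟨η, hηW⟩ : (W : Y.Opens))
  haveI := W.2.isLocalization_stalk ⟨η, hηW⟩
  rw [germContractionIdeal_of_mem η _ hηW]
  have hst : stalkIdeal X η = (X.ideal W).map (algebraMap Γ(Y, W) (Y.presheaf.stalk η)) :=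
    stalkIdeal_eq_map_germ X W hηW
  rw [hst] at hprinc hx
  exact isHomogeneous_comap_weightedMonomialIdeal_unconditional (k := k) 𝒜 (X.ideal W) hX
    (W.2.primeIdealOf ⟨η, hηW⟩).asIdeal hP (Y.presheaf.stalk η) hreg hdim hprinc x w ℓ hx n

end Scheme

end Summit.ResolutionOfSingularities.ResolutionOfSingularities.Theorems.OrbitCentreHomogeneous

end
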